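import Summits.MatrixMultiplication.MatrixMultiplication.Theorems.EdgePencilTropicalLevels
import HarnessLib

/-!
# The thickened edge FACTORS OFF in `T₄(F)`: `[W_n^{(e)}] = [P_e]·[D_n]` with `P_e` the EPR pair of rank `e`
# on parties `0, 1` — so the edge profile of a spectral point is its value on ONE EPR pair, and the target of
# record reads «EPR-seeing points value the diamond below `n⁴`»

Support kernel for `stmt-MatrixMultiplication-26697` (`TetraExcessZero`, route `TetrahedronCarving`; cut of
record `closes (TetraExcessZero) (TetraPlusTwo) : ω = 2`, UNCHANGED; lineage `decomp-mm-lens-6`, generation 43).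
No item is added or changed; no definition is introduced (`P_e` is the explicit tensor
`fun a : Fin 4 → Fin e => ind (a 0 = a 1)`, the EPR pair `Σ_{b<e} e_b ⊗ e_b` on parties `0,1` with flat
rank-one legs at parties `2,3`; `ind` is the tree's indicator `EdgePencilCore.ind`). Notation as in
`EdgePencilTropicalPair`/`Levels`: `W_n^{(e)} = sixTetra F n e`, `D_n = W_n^{(1)}`, `X₄(F) =
DTensorClass.asymptoticSpectrumDTensors F 2`, `[t] = DTensorClass.mk t`, `RUNG♭(δ, N) : [W_N^{(⌈N^δ⌉)}] ≲
[D_N] + N⁴`, `TROP(n, e) : ∀ φ ∈ X₄(F), φ[W_n^{(e)}] ≤ max (φ[D_n], n⁴)`.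

§20 THE PAIR FACTOR (`mk_sixTetra_eq_pair_mul_diamond`, `e ≤ n`, `1 ≤ n`): **`[W_n^{(e)}] = [P_e]·[D_n]`** —
a CLASS EQUALITY in `T₄(F)` (restrictions both ways: `restricts_pair_kron_diamond_sixTetra` routes the label
`ℓ₀₁` of parties `0,1` into the pair and pins parties `2,3` to block `0`; conversely `P_e ⊠ D_n` is a leg-wise
pullback of `W_n^{(e)}` times rank-one leg factors, `pair_mul_diamond_le_mk_sixTetra`). It refines the list
price `[W_n^{(e)}] ≤ e·[D_n]` (`[P_e] ≤ ⟨e⟩`) and explains the edge profile of `EdgePencilFlatSummandProfile`: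
for every `φ ∈ X₄(F)`, **`φ[W_n^{(e)}] = φ[P_e]·φ[D_n]`** (`spectrum_sixTetra_eq_pair_mul`) with
`1 ≤ φ[P_e] ≤ e` (`one_le_spectrum_pair`, `spectrum_pair_le`) — the thickening ratio is INTRINSIC to the point
(its value on one EPR pair across the missing edge) and independent of the level `n`.

§21 THE TARGET OF RECORD, FINAL FORM. With `s_φ := φ[P_2] ∈ [1, 2]` («`φ` SEES the pair» iff `s_φ > 1`;
the flattenings grouping `0` with `1` and all functionals supported on parties `2,3` are blind, `s_φ = 1`;
`ζ^{(02)}, ζ^{(03)}, ζ^{(0)}, ζ^{(1)}` see with `s = 2`; quantum functionals see with `s = 2^{θ₀+θ₁}`):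

  `TROP(n, e) ⟺ ∀ φ ∈ X₄(F), φ[P_e] = 1 ∨ φ[P_e]·φ[D_n] ≤ n⁴`     (`trop_iff_blind_or_subflat`)

and, through `EdgePencilTropicalLevels.exists_flatPurchase_iff_exists_trop`,

  `(∃ δ ∈ (0,1], RUNG♭(δ, N) at infinitely many N) ⟺
     ∃ n ≥ 2, ∀ φ ∈ X₄(F), φ[P_2] = 1 ∨ φ[P_2]·φ[D_n] ≤ n⁴`          (`exists_flatPurchase_iff_seeing_subflat`):

**the flat-summand purchase holds for some exponent iff at some base every 4-party spectral point that sees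
an EPR pair across the missing edge values the diamond at most `n⁴ / φ[P_2] < n⁴`.** Compare `HalfAlpha`
(`ψ = 4`): EVERY point values the diamond at most `n⁴` at every base. The two are formally incomparable (the
purchase asks nothing of pair-blind points, and a factor `φ[P_2] > 1` more of pair-seeing ones); the KILL TEST
of record becomes: at every base `n ≥ 2`, a pair-seeing point with `φ[P_2]·φ[D_n] > n⁴`
(`not_exists_flatPurchase_iff_seeing`).

References: Strassen 1988 (spectral characterisation of `≲`) [Strassen1988]; Zuiddam 2018, Thm. 2.12
[Zuiddam2018]; Christandl–Vrana–Zuiddam 2023, Thm. 1.1, §1.2 (graph tensors, EPR pairs as edges)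
[ChristandlVranaZuiddam2023]; Christandl–Vrana–Zuiddam, arXiv:1609.07476, §1.1 [ChristandlVranaZuiddam2016].
No `sorry`, no new axiom, no instance, no notation, no definition.
-/

noncomputable section

set_option linter.dupNamespace false

open Finset Literature.Computability.AlgebraicComplexity
open Summit.MatrixMultiplication.MatrixMultiplication.Theorems.TetrahedronTensor
open Summit.MatrixMultiplication.MatrixMultiplication.Theorems.TetraDiagonal
open Summit.MatrixMultiplication.MatrixMultiplication.Theses.TetrahedronCarving

namespace Summit.MatrixMultiplication.MatrixMultiplication.Theorems.EdgePencil

/-! ## §20 The pair factor -/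

section PairFactor

variable {F : Type*} [Field F]

/-- Leg-wise diagonal scalings are restrictions (general index type): `[(∏_v L_v(i_v))·t] ≤ [t]`.
[cite: ChristandlVranaZuiddam2023, §1.1] -/
theorem mk_legMul_le_of {κ : Type*} [Fintype κ] [DecidableEq κ] (L : Fin 4 → κ → F) (t : (Fin 4 → κ) → F) :
    DTensorClass.mk (fun i : Fin 4 → κ => (∏ v, L v (i v)) * t i) ≤ DTensorClass.mk t := by
  classical
  rw [DTensorClass.mk_le_mk_iff]
  refine ⟨fun v (a : κ) (b : κ) => if b = a then L v a else 0, ?_⟩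
  funext i
  rw [DTensor.apply_apply_eq]
  have h : ∀ k : Fin 4 → κ,
      (∏ j, (if k j = i j then L j (i j) else 0)) * t k =
        if k = i then (∏ v, L v (i v)) * t k else 0 := by
    intro k
    by_cases hk : k = i
    · subst hk
      simp
    · obtain ⟨j, hj⟩ := Function.ne_iff.1 hk
      rw [Finset.prod_eq_zero (Finset.mem_univ j) (if_neg hj), zero_mul, if_neg hk]
  simp_rw [h]
  rw [Finset.sum_ite_eq' Finset.univ i]
  simp

/-- **`P_e ⊠ D_n ≥ W_n^{(e)}`**: the thinned tetrahedron is a restriction of the Kronecker product of the EPR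
pair `P_e` (parties `0,1`) with the diamond: parties `0,1` send the label `ℓ₀₁` into the pair index and keep
`(0, ℓ₀₂, ℓ₀₃)` resp. `(0, ℓ₁₂, ℓ₁₃)`; parties `2,3` keep their label and sit in block `0` of their flat leg.
[cite: ChristandlVranaZuiddam2023, §1.1] -/
theorem restricts_pair_kron_diamond_sixTetra {n : ℕ} (hn : 1 ≤ n) (e : ℕ) :
    DTensor.Restricts (DTensor.kron (fun a : Fin 4 → Fin e => (ind (a 0 = a 1) : F)) (sixTetra F n 1))
      (sixTetra F n e) := by
  classical
  haveI : NeZero n := NeZero.of_pos hn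
  set Pe : (Fin 4 → Fin e) → F := fun a => ind (a 0 = a 1) with hPe
  set ρ : Fin 4 → Fin (n ^ 3) → Fin (n ^ 3) :=
    fun v x => if v = 0 ∨ v = 1 then enc 0 (lab x 1) (lab x 2) else x with hρ
  set χ : Fin 4 → Fin (n ^ 3) → Fin e → F :=
    fun v x b => if v = 0 ∨ v = 1 then (if (b : ℕ) = (lab x 0 : ℕ) then 1 else 0)
      else (if (b : ℕ) = 0 then 1 else 0) with hχ
  refine ⟨fun v x k => χ v x k.1 * (if k.2 = ρ v x then (1 : F) else 0), ?_⟩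
  funext x
  rw [DTensor.apply_apply_eq, sum_arrow_prod_eq]
  simp only [DTensor.kron_apply]
  set y₀ : Fin 4 → Fin (n ^ 3) := fun v => ρ v (x v) with hy₀
  have inner : ∀ a : Fin 4 → Fin e,
      (∑ y : Fin 4 → Fin (n ^ 3), (∏ v, χ v (x v) (a v) * (if y v = ρ v (x v) then (1 : F) else 0)) *
        (Pe a * sixTetra F n 1 y)) =
      (∏ v, χ v (x v) (a v)) * Pe a * sixTetra F n 1 y₀ := by
    intro a
    have hterm : ∀ y : Fin 4 → Fin (n ^ 3),
        (∏ v, χ v (x v) (a v) * (if y v = ρ v (x v) then (1 : F) else 0)) *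
          (Pe a * sixTetra F n 1 y) =
        (∏ v, χ v (x v) (a v)) * Pe a *
          ((∏ v, (if y v = y₀ v then (1 : F) else 0)) * sixTetra F n 1 y) := by
      intro y
      rw [Finset.prod_mul_distrib]
      ring
    simp_rw [hterm, DTensor.prod_ite_eq_eq, ← Finset.mul_sum, Finset.sum_ite_eq', Finset.mem_univ,
      if_true]
  simp_rw [inner]
  rw [← Finset.sum_mul]
  have hblock : ∀ a : Fin 4 → Fin e, (∏ v, χ v (x v) (a v)) =
      (if ((a 0 : Fin e) : ℕ) = (lab (x 0) 0 : ℕ) then (1 : F) else 0) *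
        (if ((a 1 : Fin e) : ℕ) = (lab (x 1) 0 : ℕ) then (1 : F) else 0) *
        (if ((a 2 : Fin e) : ℕ) = 0 then (1 : F) else 0) *
        (if ((a 3 : Fin e) : ℕ) = 0 then (1 : F) else 0) := by
    intro a
    rw [Fin.prod_univ_four]
    simp [hχ]
  simp_rw [hblock]
  -- the `a`-sum is the indicator of `ℓ₀₁ < e ∧ ℓ₀₁(x 0) = ℓ₀₁(x 1)`
  have hsum : (∑ a : Fin 4 → Fin e,
      (if ((a 0 : Fin e) : ℕ) = (lab (x 0) 0 : ℕ) then (1 : F) else 0) *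
        (if ((a 1 : Fin e) : ℕ) = (lab (x 1) 0 : ℕ) then (1 : F) else 0) *
        (if ((a 2 : Fin e) : ℕ) = 0 then (1 : F) else 0) *
        (if ((a 3 : Fin e) : ℕ) = 0 then (1 : F) else 0) * Pe a) =
      ind (((lab (x 0) 0 : ℕ) < e) ∧ lab (x 0) 0 = lab (x 1) 0) := by
    by_cases h : ((lab (x 0) 0 : ℕ) < e) ∧ lab (x 0) 0 = lab (x 1) 0
    · rw [ind, if_pos h]
      obtain ⟨hlt, h01⟩ := h
      set b : Fin e := ⟨(lab (x 0) 0 : ℕ), hlt⟩ with hb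
      set z : Fin e := ⟨0, by omega⟩ with hz
      set a₀ : Fin 4 → Fin e := fun j => if j = 0 ∨ j = 1 then b else z with ha₀
      rw [Finset.sum_eq_single_of_mem a₀ (Finset.mem_univ _)]
      · simp [ha₀, hPe, ind, hb, hz, h01]
      · intro a _ hne
        by_cases h0 : ((a 0 : Fin e) : ℕ) = (lab (x 0) 0 : ℕ)
        · by_cases h1 : ((a 1 : Fin e) : ℕ) = (lab (x 1) 0 : ℕ)
          · by_cases h2 : ((a 2 : Fin e) : ℕ) = 0
            · by_cases h3 : ((a 3 : Fin e) : ℕ) = 0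
              · exfalso
                apply hne
                funext j
                fin_cases j
                · exact Fin.ext (by simp [ha₀, hb, h0])
                · exact Fin.ext (by simp [ha₀, hb, h1, h01])
                · exact Fin.ext (by simp [ha₀, hz, h2])
                · exact Fin.ext (by simp [ha₀, hz, h3])
              · rw [if_neg h3]; ring
            · rw [if_neg h2]; ring
          · rw [if_neg h1]; ring
        · rw [if_neg h0]; ring
    · rw [ind, if_neg h]
      refine Finset.sum_eq_zero fun a _ => ?_
      by_cases h0 : ((a 0 : Fin e) : ℕ) = (lab (x 0) 0 : ℕ)
      · by_cases h1 : ((a 1 : Fin e) : ℕ) = (lab (x 1) 0 : ℕ)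
        · by_cases h01 : a 0 = a 1
          · exfalso
            apply h
            refine ⟨?_, ?_⟩
            · rw [← h0]; exact (a 0).isLt
            · apply Fin.ext
              rw [← h0, ← h1, h01]
          · simp [hPe, ind, h01]
        · rw [if_neg h1]; ring
      · rw [if_neg h0]; ring
  rw [hsum]
  have h0 : y₀ 0 = enc 0 (lab (x 0) 1) (lab (x 0) 2) := by simp [hy₀, hρ]
  have h1 : y₀ 1 = enc 0 (lab (x 1) 1) (lab (x 1) 2) := by simp [hy₀, hρ]
  have h2 : y₀ 2 = x 2 := by simp [hy₀, hρ]
  have h3 : y₀ 3 = x 3 := by simp [hy₀, hρ]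
  rw [sixTetra_apply, sixTetra_apply, h0, h1, h2, h3, ind_mul_ind]
  simp only [lab_enc_fst, lab_enc_snd, lab_enc_thd, Fin.val_zero, Nat.lt_one_iff, true_and]
  exact ind_congr (by tauto)

/-- **`[W_n^{(e)}] ≤ [P_e]·[D_n]`** (`1 ≤ n`). [cite: ChristandlVranaZuiddam2023, §1.2] -/
theorem mk_sixTetra_le_pair_mul_diamond {n : ℕ} (hn : 1 ≤ n) (e : ℕ) :
    DTensorClass.mk (sixTetra F n e) ≤
      DTensorClass.mk (fun a : Fin 4 → Fin e => (ind (a 0 = a 1) : F)) * DTensorClass.mk (sixTetra F n 1) := by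
  rw [DTensorClass.mk_mul_mk, DTensorClass.mk_le_mk_iff]
  exact restricts_pair_kron_diamond_sixTetra hn e

/-- **`[P_e]·[D_n] ≤ [W_n^{(e)}]`** (`e ≤ n`): `P_e ⊠ D_n` is, up to rank-one leg factors on the `ℓ₀₁`-slots
of parties `0,1`, the leg-wise pullback of `W_n^{(e)}` along `(b, x) ↦ (b, ℓ₁(x), ℓ₂(x))` (parties `0,1`) and
`(b, x) ↦ x` (parties `2,3`). [cite: ChristandlVranaZuiddam2023, §1.2] -/
theorem pair_mul_diamond_le_mk_sixTetra {n e : ℕ} (he : e ≤ n) :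
    DTensorClass.mk (fun a : Fin 4 → Fin e => (ind (a 0 = a 1) : F)) * DTensorClass.mk (sixTetra F n 1) ≤
      DTensorClass.mk (sixTetra F n e) := by
  classical
  rw [DTensorClass.mk_mul_mk]
  -- the pullback map and the leg factors
  set f : Fin 4 → (Fin e × Fin (n ^ 3)) → Fin (n ^ 3) :=
    fun v k => if v = 0 ∨ v = 1 then enc (Fin.castLE he k.1) (lab k.2 1) (lab k.2 2) else k.2 with hf
  set L : Fin 4 → (Fin e × Fin (n ^ 3)) → F :=
    fun v k => if v = 0 ∨ v = 1 then (if (lab k.2 0 : ℕ) = 0 then 1 else 0) else 1 with hL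
  have hpre : DTensorClass.mk (fun i : Fin 4 → Fin e × Fin (n ^ 3) => sixTetra F n e (fun j => f j (i j))) ≤
      DTensorClass.mk (sixTetra F n e) := by
    rw [DTensorClass.mk_le_mk_iff]
    exact restricts_precomp_legwise f _
  refine le_trans (le_of_eq ?_) ((mk_legMul_le_of L _).trans hpre)
  congr 1
  funext i
  rw [DTensor.kron_apply]
  have hLi : (∏ v, L v (i v)) = (if (lab (i 0).2 0 : ℕ) = 0 then (1 : F) else 0) *
      (if (lab (i 1).2 0 : ℕ) = 0 then (1 : F) else 0) := by
    rw [Fin.prod_univ_four]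
    simp [hL]
  have hf0 : f 0 (i 0) = enc (Fin.castLE he (i 0).1) (lab (i 0).2 1) (lab (i 0).2 2) := by simp [hf]
  have hf1 : f 1 (i 1) = enc (Fin.castLE he (i 1).1) (lab (i 1).2 1) (lab (i 1).2 2) := by simp [hf]
  have hf2 : f 2 (i 2) = (i 2).2 := by simp [hf]
  have hf3 : f 3 (i 3) = (i 3).2 := by simp [hf]
  rw [hLi, sixTetra_apply, sixTetra_apply, hf0, hf1, hf2, hf3]
  simp only [lab_enc_fst, lab_enc_snd, lab_enc_thd]
  have e1 : (if (lab (i 0).2 0 : ℕ) = 0 then (1 : F) else 0) = ind ((lab (i 0).2 0 : ℕ) = 0) := rfl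
  have e2 : (if (lab (i 1).2 0 : ℕ) = 0 then (1 : F) else 0) = ind ((lab (i 1).2 0 : ℕ) = 0) := rfl
  rw [e1, e2, ind_mul_ind, ind_mul_ind, ind_mul_ind]
  refine ind_congr ?_
  simp only [Fin.ext_iff, Fin.val_castLE, Nat.lt_one_iff]
  constructor
  · rintro ⟨h01, h00, h0eq, hrest⟩
    exact ⟨⟨h00, by omega⟩, (i 0).1.isLt, h01, hrest⟩
  · rintro ⟨⟨h00, h10⟩, -, h01, hrest⟩
    exact ⟨h01, h00, by omega, hrest⟩

/-- **THE PAIR FACTOR**: `[W_n^{(e)}] = [P_e]·[D_n]` in `T₄(F)` (`e ≤ n`, `1 ≤ n`).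
[cite: ChristandlVranaZuiddam2023, §1.2] -/
theorem mk_sixTetra_eq_pair_mul_diamond {n e : ℕ} (hn : 1 ≤ n) (he : e ≤ n) :
    DTensorClass.mk (sixTetra F n e) =
      DTensorClass.mk (fun a : Fin 4 → Fin e => (ind (a 0 = a 1) : F)) * DTensorClass.mk (sixTetra F n 1) :=
  le_antisymm (mk_sixTetra_le_pair_mul_diamond hn e) (pair_mul_diamond_le_mk_sixTetra he)

end PairFactor

/-! ## §21 Spectral reading: the profile is the value on one EPR pair; the target of record, final form -/

section Seeing

variable {F : Type*} [Field F]

/-- **`φ[W_n^{(e)}] = φ[P_e]·φ[D_n]`** for every spectral point (`e ≤ n`, `1 ≤ n`).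
[cite: Zuiddam2018, Thm. 2.12] -/
theorem spectrum_sixTetra_eq_pair_mul {n e : ℕ} (hn : 1 ≤ n) (he : e ≤ n) {φ : DTensorClass F 4 → ℝ}
    (hφ : φ ∈ DTensorClass.asymptoticSpectrumDTensors F 2) :
    φ (DTensorClass.mk (sixTetra F n e)) =
      φ (DTensorClass.mk (fun a : Fin 4 → Fin e => (ind (a 0 = a 1) : F))) *
        φ (DTensorClass.mk (sixTetra F n 1)) := by
  rw [mk_sixTetra_eq_pair_mul_diamond (F := F) hn he, (DTensorClass.mem_asymptoticSpectrumDTensors_iff.1 hφ).map_mul]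

/-- `1 ≤ φ[P_e]` (`1 ≤ e ≤ n` for some `n ≥ 1`; read off `φ[D_n] ≤ φ[W_n^{(e)}] = φ[P_e]·φ[D_n]`,
`φ[D_n] ≥ 1`). [cite: Zuiddam2018, Def. 2.11] -/
theorem one_le_spectrum_pair {e : ℕ} (he : 1 ≤ e) {φ : DTensorClass F 4 → ℝ}
    (hφ : φ ∈ DTensorClass.asymptoticSpectrumDTensors F 2) :
    1 ≤ φ (DTensorClass.mk (fun a : Fin 4 → Fin e => (ind (a 0 = a 1) : F))) := by
  have hD1 : 1 ≤ φ (DTensorClass.mk (sixTetra F e 1)) := one_le_spectrum_sixTetra (F := F) he le_rfl hφ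
  have h := spectrum_diamond_le_sixTetra (F := F) (n := e) he hφ
  rw [spectrum_sixTetra_eq_pair_mul (F := F) he le_rfl hφ] at h
  nlinarith

/-- `φ[P_e] ≤ e` (list price `φ[W] ≤ e·φ[D]`). [cite: Zuiddam2018, Def. 2.11] -/
theorem spectrum_pair_le {e : ℕ} (he : 1 ≤ e) {φ : DTensorClass F 4 → ℝ}
    (hφ : φ ∈ DTensorClass.asymptoticSpectrumDTensors F 2) :
    φ (DTensorClass.mk (fun a : Fin 4 → Fin e => (ind (a 0 = a 1) : F))) ≤ e := by
  have hD1 : 1 ≤ φ (DTensorClass.mk (sixTetra F e 1)) := one_le_spectrum_sixTetra (F := F) he le_rfl hφ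
  have h := spectrum_sixTetra_le_mul_diamond (F := F) (n := e) he e hφ
  rw [spectrum_sixTetra_eq_pair_mul (F := F) he le_rfl hφ] at h
  nlinarith

/-- **`TROP(n, e) ⟺ every point is pair-blind or values the diamond at most `n⁴/φ[P_e]`**
(`1 ≤ e ≤ n`). [cite: Strassen1988, Thm. (spectral characterisation)] -/
theorem trop_iff_blind_or_subflat {n e : ℕ} (he1 : 1 ≤ e) (he : e ≤ n) :
    (∀ φ ∈ DTensorClass.asymptoticSpectrumDTensors F 2,
      φ (DTensorClass.mk (sixTetra F n e)) ≤ max (φ (DTensorClass.mk (sixTetra F n 1))) ((n : ℝ) ^ 4)) ↔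
    ∀ φ ∈ DTensorClass.asymptoticSpectrumDTensors F 2,
      φ (DTensorClass.mk (fun a : Fin 4 → Fin e => (ind (a 0 = a 1) : F))) = 1 ∨
        φ (DTensorClass.mk (fun a : Fin 4 → Fin e => (ind (a 0 = a 1) : F))) *
          φ (DTensorClass.mk (sixTetra F n 1)) ≤ (n : ℝ) ^ 4 := by
  have hn : 1 ≤ n := he1.trans he
  refine forall₂_congr fun φ hφ => ?_
  have hD1 : 1 ≤ φ (DTensorClass.mk (sixTetra F n 1)) := one_le_spectrum_sixTetra (F := F) hn le_rfl hφ
  have hP1 := one_le_spectrum_pair (F := F) he1 hφ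
  rw [trop_iff_blind_or_le (F := F) he1 hφ, spectrum_sixTetra_eq_pair_mul (F := F) hn he hφ]
  refine or_congr ⟨fun h => ?_, fun h => by rw [h, one_mul]⟩ Iff.rfl
  -- `s·a = a` with `a ≥ 1` forces `s = 1`
  have ha0 : 0 < φ (DTensorClass.mk (sixTetra F n 1)) := by linarith
  have := mul_right_cancel₀ ha0.ne' (h.trans (one_mul _).symm)
  exact this

/-- **THE TARGET OF RECORD, FINAL FORM**: the flat-summand purchase holds at infinitely many levels for some
exponent `δ ∈ (0,1]` iff at some base `n ≥ 2` every 4-party spectral point that SEES an EPR pair across the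
missing edge (`φ[P_2] > 1`) values the diamond at most `n⁴/φ[P_2]`.
[cite: Strassen1988, Thm. (spectral characterisation)] -/
theorem exists_flatPurchase_iff_seeing_subflat (F : Type*) [Field F] :
    (∃ δ : ℝ, 0 < δ ∧ δ ≤ 1 ∧ ∀ N₀ : ℕ, ∃ N : ℕ, N₀ ≤ N ∧
      AsympLe (fun x y : DTensorClass F 4 => x ≤ y) (DTensorClass.mk (sixTetra F N (rectDim N δ)))
        (DTensorClass.mk (sixTetra F N 1) + ((N ^ 4 : ℕ) : DTensorClass F 4))) ↔
    ∃ n : ℕ, 2 ≤ n ∧ ∀ φ ∈ DTensorClass.asymptoticSpectrumDTensors F 2,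
      φ (DTensorClass.mk (fun a : Fin 4 → Fin 2 => (ind (a 0 = a 1) : F))) = 1 ∨
        φ (DTensorClass.mk (fun a : Fin 4 → Fin 2 => (ind (a 0 = a 1) : F))) *
          φ (DTensorClass.mk (sixTetra F n 1)) ≤ (n : ℝ) ^ 4 := by
  rw [exists_flatPurchase_iff_exists_trop F]
  refine exists_congr fun n => and_congr_right fun hn => ?_
  exact trop_iff_blind_or_subflat (F := F) (by norm_num) hn

/-- **THE KILL TEST OF RECORD, FINAL FORM**: no exponent works iff at every base `n ≥ 2` some pair-seeing
point has `φ[P_2]·φ[D_n] > n⁴`. [cite: Strassen1988, Thm. (spectral characterisation)] -/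
theorem not_exists_flatPurchase_iff_seeing (F : Type*) [Field F] :
    (¬ ∃ δ : ℝ, 0 < δ ∧ δ ≤ 1 ∧ ∀ N₀ : ℕ, ∃ N : ℕ, N₀ ≤ N ∧
      AsympLe (fun x y : DTensorClass F 4 => x ≤ y) (DTensorClass.mk (sixTetra F N (rectDim N δ)))
        (DTensorClass.mk (sixTetra F N 1) + ((N ^ 4 : ℕ) : DTensorClass F 4))) ↔
    ∀ n : ℕ, 2 ≤ n → ∃ φ ∈ DTensorClass.asymptoticSpectrumDTensors F 2,
      1 < φ (DTensorClass.mk (fun a : Fin 4 → Fin 2 => (ind (a 0 = a 1) : F))) ∧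
        (n : ℝ) ^ 4 < φ (DTensorClass.mk (fun a : Fin 4 → Fin 2 => (ind (a 0 = a 1) : F))) *
          φ (DTensorClass.mk (sixTetra F n 1)) := by
  rw [exists_flatPurchase_iff_seeing_subflat F]
  constructor
  · intro h n hn
    by_contra hne
    refine h ⟨n, hn, fun φ hφ => ?_⟩
    by_contra hφbad
    rw [not_or] at hφbad
    refine hne ⟨φ, hφ, ?_, not_le.mp hφbad.2⟩
    exact lt_of_le_of_ne (one_le_spectrum_pair (F := F) (by norm_num) hφ) (Ne.symm hφbad.1)
  · rintro h ⟨n, hn, hT⟩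
    obtain ⟨φ, hφ, hsee, hbig⟩ := h n hn
    rcases hT φ hφ with hb | hs
    · exact absurd hb (ne_of_gt hsee)
    · exact absurd hs (not_le.mpr hbig)

end Seeing

end Summit.MatrixMultiplication.MatrixMultiplication.Theorems.EdgePencil

end
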